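import Summits.Ventures.PercRepro.RankLevelSetRuleQCellFiveSliceThreeSums
import Summits.Ventures.PercRepro.RankLevelSetRuleQCellSixSliceFourSums

/-!
# PercRepro — THE BORDERLINE SLICE `u = 5` OF THE CELL `(q+7, q)`, PART I: THE SLICE SUMS IN CLOSED FORM
(night-1, gen 17; dossier §28; generated from the exact polynomial data by mining/night-1/g17/gen_border.py)

The module RankLevelSetRuleQCellSevenSliceFive proves `Φ(q+7, q) ≤ R̂(q, 7, q−5)` for every `q ≥ 5` — Rule Q's equal split pays the borderline
slice `u = q − #P = 5` of every cell `(q+7, q)` (the slices `2 ≤ u ≤ 4` fail for `q` large, §27.6–27.11). This part holds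
the combinatorial half of the analytic regime (`q = t + 9`, `m = t + 4`, `x = 4^{t+6}/C(2t+12, t+6)`):
* `rhat_seven_slice_five_ge` — `R̂(m+5, 7, m) ≥ Σ_{j<7} C(12, j)·S_j` (every `m̂ ≤ C(q+j+a, a+j)`, `mhat_le_choose`;
  the truncated top term is kept);
* the half row of the reference row `2m+5` (odd: Nat.sum_range_choose_halfway), the rows `2t+13 … 2t+18` by the row step `sum_range_choose_succ_row`,
  the ratios between the binomials of those rows, the Wallis lower bound `3t + 19 ≤ x²` (`centralBinom_sq_mul_le`);
* **`sliceFive_S1_zero … `** — the 6 sums `S₁(q+i, m)`, `i = 0 … 5`, in closed form `(A_i − B_i·x)/D_i` (polynomials in `t`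
  with nonnegative coefficients; `slice_sum_one_eq` through the rows).
Twin: mining/night-1/g17/border_polys.py (own exact rationals). Axioms: standard.
-/

namespace PercRepro

open Finset

/-- **The half row, odd case `2m+5`**: `Σ_{i<m} C(2m+5, i) + C(2m+5, m) + C(2m+5, m+1) + C(2m+5, m+2) = 4^{m+2}` (`Nat.sum_range_choose_halfway`). -/
lemma sum_range_choose_half_five (m : ℕ) :
    ∑ i ∈ range m, (2 * m + 5).choose i + (2 * m + 5).choose m + (2 * m + 5).choose (m + 1) + (2 * m + 5).choose (m + 2) = 4 ^ (m + 2) := by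
  have h := Nat.sum_range_choose_halfway (m + 2)
  rw [show 2 * (m + 2) + 1 = 2 * m + 5 by ring, Finset.sum_range_succ, Finset.sum_range_succ, Finset.sum_range_succ] at h
  exact h

/-- **`R̂(m+5, 7, m) ≥ Σ_{j<7} C(12, j)·S_j`** on the slice `u = 5` (`q = m + 5`): every `m̂(q, m; a, j) ≤ C(q+j+a, a+j)`
(`mhat_le_choose`; the truncated top term only drops terms). -/
lemma rhat_seven_slice_five_ge (m : ℕ) :

    12 * ∑ a ∈ range (m + 1), (m.choose a : ℚ) / ((m + 5 + 1 + a).choose (a + 1) : ℚ)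
      + 66 * ∑ a ∈ range (m + 1), (m.choose a : ℚ) / ((m + 5 + 2 + a).choose (a + 2) : ℚ)
      + 220 * ∑ a ∈ range (m + 1), (m.choose a : ℚ) / ((m + 5 + 3 + a).choose (a + 3) : ℚ)
      + 495 * ∑ a ∈ range (m + 1), (m.choose a : ℚ) / ((m + 5 + 4 + a).choose (a + 4) : ℚ)
      + 792 * ∑ a ∈ range (m + 1), (m.choose a : ℚ) / ((m + 5 + 5 + a).choose (a + 5) : ℚ)
      + 924 * ∑ a ∈ range (m + 1), (m.choose a : ℚ) / ((m + 5 + 6 + a).choose (a + 6) : ℚ)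
      ≤ rhat (m + 5) 7 m := by
  unfold rhat
  rw [sum_Ioo_nat, show (7 : ℕ) - (0 + 1) = 1 + 1 + 1 + 1 + 1 + 1 from rfl, Finset.sum_range_succ _ (1 + 1 + 1 + 1 + 1), Finset.sum_range_succ _ (1 + 1 + 1 + 1), Finset.sum_range_succ _ (1 + 1 + 1), Finset.sum_range_succ _ (1 + 1), Finset.sum_range_succ _ (1),
    Finset.sum_range_one]
  simp only [zero_add, add_zero, Nat.reduceAdd, show m + 5 + 7 - m = 12 by omega, Nat.choose_one_right,
    show (12 : ℕ).choose 2 = 66 by decide, show (12 : ℕ).choose 3 = 220 by decide, show (12 : ℕ).choose 4 = 495 by decide, show (12 : ℕ).choose 5 = 792 by decide, show (12 : ℕ).choose 6 = 924 by decide]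
  push_cast
  have key : ∀ (j a : ℕ) (w : ℚ), 0 ≤ w →
      (m.choose a : ℚ) * w / ((m + 5 + j + a).choose (a + j) : ℚ)
        ≤ (m.choose a : ℚ) * w / (mhat (m + 5) m a j : ℚ) := by
    intro j a w hw
    apply div_le_div_of_nonneg_left (by positivity) (by exact_mod_cast mhat_pos _ _ _ _)
    exact_mod_cast mhat_le_choose (m + 5) m a j
  have s1 : 12 * ∑ a ∈ range (m + 1), (m.choose a : ℚ) / ((m + 5 + 1 + a).choose (a + 1) : ℚ)
      ≤ ∑ a ∈ range (m + 1), (m.choose a : ℚ) * 12 / (mhat (m + 5) m a 1 : ℚ) := by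
    rw [Finset.mul_sum]
    refine Finset.sum_le_sum (fun a _ => ?_)
    rw [show (12 : ℚ) * ((m.choose a : ℚ) / ((m + 5 + 1 + a).choose (a + 1) : ℚ))
      = (m.choose a : ℚ) * 12 / ((m + 5 + 1 + a).choose (a + 1) : ℚ) by ring]
    exact key 1 a _ (by positivity)
  have s2 : 66 * ∑ a ∈ range (m + 1), (m.choose a : ℚ) / ((m + 5 + 2 + a).choose (a + 2) : ℚ)
      ≤ ∑ a ∈ range (m + 1), (m.choose a : ℚ) * 66 / (mhat (m + 5) m a 2 : ℚ) := by
    rw [Finset.mul_sum]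
    refine Finset.sum_le_sum (fun a _ => ?_)
    rw [show (66 : ℚ) * ((m.choose a : ℚ) / ((m + 5 + 2 + a).choose (a + 2) : ℚ))
      = (m.choose a : ℚ) * 66 / ((m + 5 + 2 + a).choose (a + 2) : ℚ) by ring]
    exact key 2 a _ (by positivity)
  have s3 : 220 * ∑ a ∈ range (m + 1), (m.choose a : ℚ) / ((m + 5 + 3 + a).choose (a + 3) : ℚ)
      ≤ ∑ a ∈ range (m + 1), (m.choose a : ℚ) * 220 / (mhat (m + 5) m a 3 : ℚ) := by
    rw [Finset.mul_sum]
    refine Finset.sum_le_sum (fun a _ => ?_)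
    rw [show (220 : ℚ) * ((m.choose a : ℚ) / ((m + 5 + 3 + a).choose (a + 3) : ℚ))
      = (m.choose a : ℚ) * 220 / ((m + 5 + 3 + a).choose (a + 3) : ℚ) by ring]
    exact key 3 a _ (by positivity)
  have s4 : 495 * ∑ a ∈ range (m + 1), (m.choose a : ℚ) / ((m + 5 + 4 + a).choose (a + 4) : ℚ)
      ≤ ∑ a ∈ range (m + 1), (m.choose a : ℚ) * 495 / (mhat (m + 5) m a 4 : ℚ) := by
    rw [Finset.mul_sum]
    refine Finset.sum_le_sum (fun a _ => ?_)
    rw [show (495 : ℚ) * ((m.choose a : ℚ) / ((m + 5 + 4 + a).choose (a + 4) : ℚ))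
      = (m.choose a : ℚ) * 495 / ((m + 5 + 4 + a).choose (a + 4) : ℚ) by ring]
    exact key 4 a _ (by positivity)
  have s5 : 792 * ∑ a ∈ range (m + 1), (m.choose a : ℚ) / ((m + 5 + 5 + a).choose (a + 5) : ℚ)
      ≤ ∑ a ∈ range (m + 1), (m.choose a : ℚ) * 792 / (mhat (m + 5) m a 5 : ℚ) := by
    rw [Finset.mul_sum]
    refine Finset.sum_le_sum (fun a _ => ?_)
    rw [show (792 : ℚ) * ((m.choose a : ℚ) / ((m + 5 + 5 + a).choose (a + 5) : ℚ))
      = (m.choose a : ℚ) * 792 / ((m + 5 + 5 + a).choose (a + 5) : ℚ) by ring]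
    exact key 5 a _ (by positivity)
  have s6 : 924 * ∑ a ∈ range (m + 1), (m.choose a : ℚ) / ((m + 5 + 6 + a).choose (a + 6) : ℚ)
      ≤ ∑ a ∈ range (m + 1), (m.choose a : ℚ) * 924 / (mhat (m + 5) m a 6 : ℚ) := by
    rw [Finset.mul_sum]
    refine Finset.sum_le_sum (fun a _ => ?_)
    rw [show (924 : ℚ) * ((m.choose a : ℚ) / ((m + 5 + 6 + a).choose (a + 6) : ℚ))
      = (m.choose a : ℚ) * 924 / ((m + 5 + 6 + a).choose (a + 6) : ℚ) by ring]
    exact key 6 a _ (by positivity)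
  linarith [s1, s2, s3, s4, s5, s6]

/-- The row `2t+13` (the reference row `2m+5`, `m = t + 4`): `P₀ = 4^{t+6} − Σ_{l≤2} C(2t+13, t+4+l)`. -/
lemma sliceFive_row0 (t : ℕ) :
    ∑ i ∈ range (t + 4), ((2 * t + 13).choose i : ℚ)
      = (4 : ℚ) ^ (t + 6) - ((2 * t + 13).choose (t + 4) : ℚ) - ((2 * t + 13).choose (t + 5) : ℚ) - ((2 * t + 13).choose (t + 6) : ℚ) := by
  have h := sum_range_choose_half_five (t + 4)
  rw [show 2 * (t + 4) + 5 = 2 * t + 13 by ring, show t + 4 + 1 = t + 5 by ring, show t + 4 + 2 = t + 6 by ring] at h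
  have h' : ((∑ i ∈ range (t + 4), (2 * t + 13).choose i + (2 * t + 13).choose (t + 4) + (2 * t + 13).choose (t + 5) + (2 * t + 13).choose (t + 6) : ℕ) : ℚ) = ((4 ^ (t + 6) : ℕ) : ℚ) := by rw [h]
  push_cast at h'
  clear h
  linarith only [h']

/-- The row `2t+14` from the row `2t+13`: `P_1 = 2P_0 − C(2t+13, t+3)`. -/
lemma sliceFive_row1 (t : ℕ) :
    ∑ i ∈ range (t + 4), ((2 * t + 14).choose i : ℚ)
      = 2 * ∑ i ∈ range (t + 4), ((2 * t + 13).choose i : ℚ) - ((2 * t + 13).choose (t + 3) : ℚ) := by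
  have h := sum_range_choose_succ_row (2 * t + 13) (t + 3)
  rw [show 2 * t + 13 + 1 = 2 * t + 14 by ring, show t + 3 + 1 = t + 4 by ring] at h
  exact h

/-- The row `2t+15` from the row `2t+14`: `P_2 = 2P_1 − C(2t+14, t+3)`. -/
lemma sliceFive_row2 (t : ℕ) :
    ∑ i ∈ range (t + 4), ((2 * t + 15).choose i : ℚ)
      = 2 * ∑ i ∈ range (t + 4), ((2 * t + 14).choose i : ℚ) - ((2 * t + 14).choose (t + 3) : ℚ) := by
  have h := sum_range_choose_succ_row (2 * t + 14) (t + 3)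
  rw [show 2 * t + 14 + 1 = 2 * t + 15 by ring, show t + 3 + 1 = t + 4 by ring] at h
  exact h

/-- The row `2t+16` from the row `2t+15`: `P_3 = 2P_2 − C(2t+15, t+3)`. -/
lemma sliceFive_row3 (t : ℕ) :
    ∑ i ∈ range (t + 4), ((2 * t + 16).choose i : ℚ)
      = 2 * ∑ i ∈ range (t + 4), ((2 * t + 15).choose i : ℚ) - ((2 * t + 15).choose (t + 3) : ℚ) := by
  have h := sum_range_choose_succ_row (2 * t + 15) (t + 3)
  rw [show 2 * t + 15 + 1 = 2 * t + 16 by ring, show t + 3 + 1 = t + 4 by ring] at h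
  exact h

/-- The row `2t+17` from the row `2t+16`: `P_4 = 2P_3 − C(2t+16, t+3)`. -/
lemma sliceFive_row4 (t : ℕ) :
    ∑ i ∈ range (t + 4), ((2 * t + 17).choose i : ℚ)
      = 2 * ∑ i ∈ range (t + 4), ((2 * t + 16).choose i : ℚ) - ((2 * t + 16).choose (t + 3) : ℚ) := by
  have h := sum_range_choose_succ_row (2 * t + 16) (t + 3)
  rw [show 2 * t + 16 + 1 = 2 * t + 17 by ring, show t + 3 + 1 = t + 4 by ring] at h
  exact h

/-- The row `2t+18` from the row `2t+17`: `P_5 = 2P_4 − C(2t+17, t+3)`. -/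
lemma sliceFive_row5 (t : ℕ) :
    ∑ i ∈ range (t + 4), ((2 * t + 18).choose i : ℚ)
      = 2 * ∑ i ∈ range (t + 4), ((2 * t + 17).choose i : ℚ) - ((2 * t + 17).choose (t + 3) : ℚ) := by
  have h := sum_range_choose_succ_row (2 * t + 17) (t + 3)
  rw [show 2 * t + 17 + 1 = 2 * t + 18 by ring, show t + 3 + 1 = t + 4 by ring] at h
  exact h

/-- `C(2t+13, t+5) = C(2t+13, t+4)·(t+9)/(t+5)`. -/
lemma sliceFive_c1 (t : ℕ) :
    ((2 * t + 13).choose (t + 5) : ℚ) = ((2 * t + 13).choose (t + 4) : ℚ) * ((t : ℚ) + 9) / ((t : ℚ) + 5) := by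
  have h := Nat.choose_succ_right_eq (2 * t + 13) (t + 4)
  rw [show t + 4 + 1 = t + 5 by ring, show 2 * t + 13 - (t + 4) = t + 9 by omega] at h
  have h' : ((2 * t + 13).choose (t + 5) : ℚ) * ((t : ℚ) + 5) = ((2 * t + 13).choose (t + 4) : ℚ) * ((t : ℚ) + 9) := by
    exact_mod_cast h
  clear h
  rw [eq_div_iff (by positivity)]
  linarith only [h']

/-- `C(2t+13, t+6) = C(2t+13, t+5)·(t+8)/(t+6)`. -/
lemma sliceFive_c2 (t : ℕ) :
    ((2 * t + 13).choose (t + 6) : ℚ) = ((2 * t + 13).choose (t + 5) : ℚ) * ((t : ℚ) + 8) / ((t : ℚ) + 6) := by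
  have h := Nat.choose_succ_right_eq (2 * t + 13) (t + 5)
  rw [show t + 5 + 1 = t + 6 by ring, show 2 * t + 13 - (t + 5) = t + 8 by omega] at h
  have h' : ((2 * t + 13).choose (t + 6) : ℚ) * ((t : ℚ) + 6) = ((2 * t + 13).choose (t + 5) : ℚ) * ((t : ℚ) + 8) := by
    exact_mod_cast h
  clear h
  rw [eq_div_iff (by positivity)]
  linarith only [h']

/-- `C(2t+12, t+6) = C(2t+13, t+6)·(t+7)/(2t+13)`. -/
lemma sliceFive_cb (t : ℕ) :
    ((2 * t + 12).choose (t + 6) : ℚ) = ((2 * t + 13).choose (t + 6) : ℚ) * ((t : ℚ) + 7) / (2 * (t : ℚ) + 13) := by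
  have h := Nat.choose_mul_succ_eq (2 * t + 12) (t + 6)
  rw [show 2 * t + 12 + 1 = 2 * t + 13 by ring, show 2 * t + 13 - (t + 6) = t + 7 by omega] at h
  have h' : ((2 * t + 12).choose (t + 6) : ℚ) * (2 * (t : ℚ) + 13) = ((2 * t + 13).choose (t + 6) : ℚ) * ((t : ℚ) + 7) := by
    exact_mod_cast h
  clear h
  rw [eq_div_iff (by positivity)]
  linarith only [h']

/-- `C(2t+13, t+3) = C(2t+13, t+4)·(t+4)/(t+10)`. -/
lemma sliceFive_cs0 (t : ℕ) :
    ((2 * t + 13).choose (t + 3) : ℚ) = ((2 * t + 13).choose (t + 4) : ℚ) * ((t : ℚ) + 4) / ((t : ℚ) + 10) := by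
  have h := Nat.choose_succ_right_eq (2 * t + 13) (t + 3)
  rw [show t + 3 + 1 = t + 4 by ring, show 2 * t + 13 - (t + 3) = t + 10 by omega] at h
  have h' : ((2 * t + 13).choose (t + 4) : ℚ) * ((t : ℚ) + 4) = ((2 * t + 13).choose (t + 3) : ℚ) * ((t : ℚ) + 10) := by
    exact_mod_cast h
  clear h
  rw [eq_div_iff (by positivity)]
  linarith only [h']

/-- `C(2t+14, t+3) = C(2t+13, t+3)·(2t+14)/(t+11)`. -/
lemma sliceFive_cs1 (t : ℕ) :
    ((2 * t + 14).choose (t + 3) : ℚ) = ((2 * t + 13).choose (t + 3) : ℚ) * (2 * (t : ℚ) + 14) / ((t : ℚ) + 11) := by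
  have h := Nat.choose_mul_succ_eq (2 * t + 13) (t + 3)
  rw [show 2 * t + 13 + 1 = 2 * t + 14 by ring, show 2 * t + 14 - (t + 3) = t + 11 by omega] at h
  have h' : ((2 * t + 13).choose (t + 3) : ℚ) * (2 * (t : ℚ) + 14) = ((2 * t + 14).choose (t + 3) : ℚ) * ((t : ℚ) + 11) := by
    exact_mod_cast h
  clear h
  rw [eq_div_iff (by positivity)]
  linarith only [h']

/-- `C(2t+15, t+3) = C(2t+14, t+3)·(2t+15)/(t+12)`. -/
lemma sliceFive_cs2 (t : ℕ) :
    ((2 * t + 15).choose (t + 3) : ℚ) = ((2 * t + 14).choose (t + 3) : ℚ) * (2 * (t : ℚ) + 15) / ((t : ℚ) + 12) := by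
  have h := Nat.choose_mul_succ_eq (2 * t + 14) (t + 3)
  rw [show 2 * t + 14 + 1 = 2 * t + 15 by ring, show 2 * t + 15 - (t + 3) = t + 12 by omega] at h
  have h' : ((2 * t + 14).choose (t + 3) : ℚ) * (2 * (t : ℚ) + 15) = ((2 * t + 15).choose (t + 3) : ℚ) * ((t : ℚ) + 12) := by
    exact_mod_cast h
  clear h
  rw [eq_div_iff (by positivity)]
  linarith only [h']

/-- `C(2t+16, t+3) = C(2t+15, t+3)·(2t+16)/(t+13)`. -/
lemma sliceFive_cs3 (t : ℕ) :
    ((2 * t + 16).choose (t + 3) : ℚ) = ((2 * t + 15).choose (t + 3) : ℚ) * (2 * (t : ℚ) + 16) / ((t : ℚ) + 13) := by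
  have h := Nat.choose_mul_succ_eq (2 * t + 15) (t + 3)
  rw [show 2 * t + 15 + 1 = 2 * t + 16 by ring, show 2 * t + 16 - (t + 3) = t + 13 by omega] at h
  have h' : ((2 * t + 15).choose (t + 3) : ℚ) * (2 * (t : ℚ) + 16) = ((2 * t + 16).choose (t + 3) : ℚ) * ((t : ℚ) + 13) := by
    exact_mod_cast h
  clear h
  rw [eq_div_iff (by positivity)]
  linarith only [h']

/-- `C(2t+17, t+3) = C(2t+16, t+3)·(2t+17)/(t+14)`. -/
lemma sliceFive_cs4 (t : ℕ) :
    ((2 * t + 17).choose (t + 3) : ℚ) = ((2 * t + 16).choose (t + 3) : ℚ) * (2 * (t : ℚ) + 17) / ((t : ℚ) + 14) := by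
  have h := Nat.choose_mul_succ_eq (2 * t + 16) (t + 3)
  rw [show 2 * t + 16 + 1 = 2 * t + 17 by ring, show 2 * t + 17 - (t + 3) = t + 14 by omega] at h
  have h' : ((2 * t + 16).choose (t + 3) : ℚ) * (2 * (t : ℚ) + 17) = ((2 * t + 17).choose (t + 3) : ℚ) * ((t : ℚ) + 14) := by
    exact_mod_cast h
  clear h
  rw [eq_div_iff (by positivity)]
  linarith only [h']

/-- `C(2t+14, t+4) = C(2t+13, t+4)·(2t+14)/(t+10)`. -/
lemma sliceFive_C1 (t : ℕ) :
    ((2 * t + 14).choose (t + 4) : ℚ) = ((2 * t + 13).choose (t + 4) : ℚ) * (2 * (t : ℚ) + 14) / ((t : ℚ) + 10) := by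
  have h := Nat.choose_mul_succ_eq (2 * t + 13) (t + 4)
  rw [show 2 * t + 13 + 1 = 2 * t + 14 by ring, show 2 * t + 14 - (t + 4) = t + 10 by omega] at h
  have h' : ((2 * t + 13).choose (t + 4) : ℚ) * (2 * (t : ℚ) + 14) = ((2 * t + 14).choose (t + 4) : ℚ) * ((t : ℚ) + 10) := by
    exact_mod_cast h
  clear h
  rw [eq_div_iff (by positivity)]
  linarith only [h']

/-- `C(2t+15, t+4) = C(2t+14, t+4)·(2t+15)/(t+11)`. -/
lemma sliceFive_C2 (t : ℕ) :
    ((2 * t + 15).choose (t + 4) : ℚ) = ((2 * t + 14).choose (t + 4) : ℚ) * (2 * (t : ℚ) + 15) / ((t : ℚ) + 11) := by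
  have h := Nat.choose_mul_succ_eq (2 * t + 14) (t + 4)
  rw [show 2 * t + 14 + 1 = 2 * t + 15 by ring, show 2 * t + 15 - (t + 4) = t + 11 by omega] at h
  have h' : ((2 * t + 14).choose (t + 4) : ℚ) * (2 * (t : ℚ) + 15) = ((2 * t + 15).choose (t + 4) : ℚ) * ((t : ℚ) + 11) := by
    exact_mod_cast h
  clear h
  rw [eq_div_iff (by positivity)]
  linarith only [h']

/-- `C(2t+16, t+4) = C(2t+15, t+4)·(2t+16)/(t+12)`. -/
lemma sliceFive_C3 (t : ℕ) :
    ((2 * t + 16).choose (t + 4) : ℚ) = ((2 * t + 15).choose (t + 4) : ℚ) * (2 * (t : ℚ) + 16) / ((t : ℚ) + 12) := by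
  have h := Nat.choose_mul_succ_eq (2 * t + 15) (t + 4)
  rw [show 2 * t + 15 + 1 = 2 * t + 16 by ring, show 2 * t + 16 - (t + 4) = t + 12 by omega] at h
  have h' : ((2 * t + 15).choose (t + 4) : ℚ) * (2 * (t : ℚ) + 16) = ((2 * t + 16).choose (t + 4) : ℚ) * ((t : ℚ) + 12) := by
    exact_mod_cast h
  clear h
  rw [eq_div_iff (by positivity)]
  linarith only [h']

/-- `C(2t+17, t+4) = C(2t+16, t+4)·(2t+17)/(t+13)`. -/
lemma sliceFive_C4 (t : ℕ) :
    ((2 * t + 17).choose (t + 4) : ℚ) = ((2 * t + 16).choose (t + 4) : ℚ) * (2 * (t : ℚ) + 17) / ((t : ℚ) + 13) := by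
  have h := Nat.choose_mul_succ_eq (2 * t + 16) (t + 4)
  rw [show 2 * t + 16 + 1 = 2 * t + 17 by ring, show 2 * t + 17 - (t + 4) = t + 13 by omega] at h
  have h' : ((2 * t + 16).choose (t + 4) : ℚ) * (2 * (t : ℚ) + 17) = ((2 * t + 17).choose (t + 4) : ℚ) * ((t : ℚ) + 13) := by
    exact_mod_cast h
  clear h
  rw [eq_div_iff (by positivity)]
  linarith only [h']

/-- `C(2t+18, t+4) = C(2t+17, t+4)·(2t+18)/(t+14)`. -/
lemma sliceFive_C5 (t : ℕ) :
    ((2 * t + 18).choose (t + 4) : ℚ) = ((2 * t + 17).choose (t + 4) : ℚ) * (2 * (t : ℚ) + 18) / ((t : ℚ) + 14) := by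
  have h := Nat.choose_mul_succ_eq (2 * t + 17) (t + 4)
  rw [show 2 * t + 17 + 1 = 2 * t + 18 by ring, show 2 * t + 18 - (t + 4) = t + 14 by omega] at h
  have h' : ((2 * t + 17).choose (t + 4) : ℚ) * (2 * (t : ℚ) + 18) = ((2 * t + 18).choose (t + 4) : ℚ) * ((t : ℚ) + 14) := by
    exact_mod_cast h
  clear h
  rw [eq_div_iff (by positivity)]
  linarith only [h']

/-- **Wallis at `k = t+6`**: `3t + 19 ≤ x²` for `x = 4^{t+6}/C(2t+12, t+6)` (`centralBinom_sq_mul_le`). -/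
lemma sliceFive_wallis (t : ℕ) :
    3 * (t : ℚ) + 19 ≤ ((4 : ℚ) ^ (t + 6) / ((2 * t + 12).choose (t + 6) : ℚ)) ^ 2 := by
  have h := centralBinom_sq_mul_le (t + 6) (by omega)
  rw [Nat.centralBinom_eq_two_mul_choose, show 2 * (t + 6) = 2 * t + 12 by ring] at h
  have h' : (((2 * t + 12).choose (t + 6) ^ 2 * (3 * (t + 6) + 1) : ℕ) : ℚ) ≤ ((16 ^ (t + 6) : ℕ) : ℚ) := by
    exact_mod_cast h
  push_cast at h'
  clear h
  have hCb : (0 : ℚ) < ((2 * t + 12).choose (t + 6) : ℚ) := by exact_mod_cast Nat.choose_pos (by omega)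
  rw [div_pow, le_div_iff₀ (pow_pos hCb 2)]
  have h16 : (16 : ℚ) ^ (t + 6) = ((4 : ℚ) ^ (t + 6)) ^ 2 := by
    rw [← pow_mul, mul_comm, pow_mul]; norm_num
  rw [← h16]
  linarith only [h']

/-- `S₁(t+9, t+4)` (the row `2t+13`) in closed form `(A − B·x)/D`. -/
lemma sliceFive_S1_zero (t : ℕ) :
    ∑ a ∈ range (t + 4 + 1), ((t + 4).choose a : ℚ) / ((t + 4 + 5 + 1 + a).choose (a + 1) : ℚ)
      = (((10062 : ℚ) + (4889 : ℚ) * (t : ℚ) + (878 : ℚ) * (t : ℚ) ^ 2 + (69 : ℚ) * (t : ℚ) ^ 3 + (2 : ℚ) * (t : ℚ) ^ 4) - ((2016 : ℚ) + (764 : ℚ) * (t : ℚ) + (96 : ℚ) * (t : ℚ) ^ 2 + (4 : ℚ) * (t : ℚ) ^ 3) * ((4 : ℚ) ^ (t + 6) / ((2 * t + 12).choose (t + 6) : ℚ))) / ((5460 : ℚ) + (3622 : ℚ) * (t : ℚ) + (896 : ℚ) * (t : ℚ) ^ 2 + (98 : ℚ) * (t : ℚ) ^ 3 + (4 : ℚ)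 * (t : ℚ) ^ 4) := by
  rw [slice_sum_one_eq (t + 4 + 5) (t + 4), show t + 4 + 5 + (t + 4) = 2 * t + 13 by ring]
  push_cast
  have hC : (0 : ℚ) < ((2 * t + 13).choose (t + 4) : ℚ) := by exact_mod_cast Nat.choose_pos (by omega)
  have hC' : ((2 * t + 13).choose (t + 4) : ℚ) ≠ 0 := hC.ne'
  rw [sliceFive_row0, sliceFive_cb, sliceFive_c2, sliceFive_c1]
  field_simp
  ring

/-- `S₁(t+10, t+4)` (the row `2t+14`) in closed form `(A − B·x)/D`. -/
lemma sliceFive_S1_one (t : ℕ) :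
    ∑ a ∈ range (t + 4 + 1), ((t + 4).choose a : ℚ) / ((t + 4 + 5 + 1 + 1 + a).choose (a + 1) : ℚ)
      = (((237900 : ℚ) + (136960 : ℚ) * (t : ℚ) + (31027 : ℚ) * (t : ℚ) ^ 2 + (3451 : ℚ) * (t : ℚ) ^ 3 + (188 : ℚ) * (t : ℚ) ^ 4 + (4 : ℚ) * (t : ℚ) ^ 5) - ((50400 : ℚ) + (24140 : ℚ) * (t : ℚ) + (4310 : ℚ) * (t : ℚ) ^ 2 + (340 : ℚ) * (t : ℚ) ^ 3 + (10 : ℚ) * (t : ℚ) ^ 4) * ((4 : ℚ) ^ (t + 6) / ((2 * t + 12).choose (t + 6) : ℚ))) / ((81900 : ℚ) + (65250 : ℚ) * (t : ℚ) + (20684 : ℚ) * (t : ℚ) ^ 2 + (3262 : ℚ) * (t : ℚ) ^ 3 + (256 : ℚ) * (t : ℚ) ^ 4 + (8 : ℚ) * (t : ℚ) ^ 5) := by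
  rw [slice_sum_one_eq (t + 4 + 5 + 1) (t + 4), show t + 4 + 5 + 1 + (t + 4) = 2 * t + 14 by ring]
  push_cast
  have hC : (0 : ℚ) < ((2 * t + 13).choose (t + 4) : ℚ) := by exact_mod_cast Nat.choose_pos (by omega)
  have hC' : ((2 * t + 13).choose (t + 4) : ℚ) ≠ 0 := hC.ne'
  rw [sliceFive_row1, sliceFive_row0, sliceFive_C1, sliceFive_cs0, sliceFive_cb, sliceFive_c2, sliceFive_c1]
  field_simp
  ring

/-- `S₁(t+11, t+4)` (the row `2t+15`) in closed form `(A − B·x)/D`. -/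
lemma sliceFive_S1_two (t : ℕ) :
    ∑ a ∈ range (t + 4 + 1), ((t + 4).choose a : ℚ) / ((t + 4 + 5 + 1 + 1 + 1 + a).choose (a + 1) : ℚ)
      = (((3050190 : ℚ) + (2013387 : ℚ) * (t : ℚ) + (544631 : ℚ) * (t : ℚ) ^ 2 + (77129 : ℚ) * (t : ℚ) ^ 3 + (6015 : ℚ) * (t : ℚ) ^ 4 + (244 : ℚ) * (t : ℚ) ^ 5 + (4 : ℚ) * (t : ℚ) ^ 6) - ((665280 : ℚ) + (379128 : ℚ) * (t : ℚ) + (85860 : ℚ) * (t : ℚ) ^ 2 + (9660 : ℚ) * (t : ℚ) ^ 3 + (540 : ℚ) * (t : ℚ) ^ 4 + (12 : ℚ) * (t : ℚ) ^ 5) * ((4 : ℚ) ^ (t + 6) / ((2 * t + 12).choose (t + 6) : ℚ))) / ((655200 : ℚ) + (603900 : ℚ) * (t : ℚ) + (230722 : ℚ) * (t : ℚ) ^ 2 + (46780 : ℚ) * (t : ℚ) ^ 3 + (5310 : ℚ) * (t : ℚ) ^ 4 + (320 : ℚ) * (t : ℚ) ^ 5 + (8 : ℚ) * (t : ℚ)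 ^ 6) := by
  rw [slice_sum_one_eq (t + 4 + 5 + 1 + 1) (t + 4), show t + 4 + 5 + 1 + 1 + (t + 4) = 2 * t + 15 by ring]
  push_cast
  have hC : (0 : ℚ) < ((2 * t + 13).choose (t + 4) : ℚ) := by exact_mod_cast Nat.choose_pos (by omega)
  have hC' : ((2 * t + 13).choose (t + 4) : ℚ) ≠ 0 := hC.ne'
  rw [sliceFive_row2, sliceFive_row1, sliceFive_row0, sliceFive_C2, sliceFive_C1, sliceFive_cs1, sliceFive_cs0, sliceFive_cb, sliceFive_c2, sliceFive_c1]
  field_simp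
  ring

/-- `S₁(t+12, t+4)` (the row `2t+16`) in closed form `(A − B·x)/D`. -/
lemma sliceFive_S1_three (t : ℕ) :
    ∑ a ∈ range (t + 4 + 1), ((t + 4).choose a : ℚ) / ((t + 4 + 5 + 1 + 1 + 1 + 1 + a).choose (a + 1) : ℚ)
      = (((84094920 : ℚ) + (62174946 : ℚ) * (t : ℚ) + (19385477 : ℚ) * (t : ℚ) ^ 2 + (3298404 : ℚ) * (t : ℚ) ^ 3 + (329971 : ℚ) * (t : ℚ) ^ 4 + (19342 : ℚ) * (t : ℚ) ^ 5 + (612 : ℚ) * (t : ℚ) ^ 6 + (8 : ℚ) * (t : ℚ) ^ 7) - ((18627840 : ℚ) + (12167904 : ℚ) * (t : ℚ) + (3288712 : ℚ) * (t : ℚ) ^ 2 + (470820 : ℚ) * (t : ℚ) ^ 3 + (37660 : ℚ) * (t : ℚ) ^ 4 + (1596 : ℚ) * (t : ℚ) ^ 5 + (28 : ℚ) * (t : ℚ) ^ 6) * ((4 : ℚ) ^ (t + 6) / ((2 * t + 12).choose (t + 6) : ℚ))) / ((11138400 : ℚ) + (11576700 : ℚ) * (t : ℚ) + (5130074 : ℚ)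 * (t : ℚ) ^ 2 + (1256704 : ℚ) * (t : ℚ) ^ 3 + (183830 : ℚ) * (t : ℚ) ^ 4 + (16060 : ℚ) * (t : ℚ) ^ 5 + (776 : ℚ) * (t : ℚ) ^ 6 + (16 : ℚ) * (t : ℚ) ^ 7) := by
  rw [slice_sum_one_eq (t + 4 + 5 + 1 + 1 + 1) (t + 4), show t + 4 + 5 + 1 + 1 + 1 + (t + 4) = 2 * t + 16 by ring]
  push_cast
  have hC : (0 : ℚ) < ((2 * t + 13).choose (t + 4) : ℚ) := by exact_mod_cast Nat.choose_pos (by omega)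
  have hC' : ((2 * t + 13).choose (t + 4) : ℚ) ≠ 0 := hC.ne'
  rw [sliceFive_row3, sliceFive_row2, sliceFive_row1, sliceFive_row0, sliceFive_C3, sliceFive_C2, sliceFive_C1, sliceFive_cs2, sliceFive_cs1, sliceFive_cs0, sliceFive_cb, sliceFive_c2, sliceFive_c1]
  field_simp
  ring

/-- `S₁(t+13, t+4)` (the row `2t+17`) in closed form `(A − B·x)/D`. -/
lemma sliceFive_S1_four (t : ℕ) :
    ∑ a ∈ range (t + 4 + 1), ((t + 4).choose a : ℚ) / ((t + 4 + 5 + 1 + 1 + 1 + 1 + 1 + a).choose (a + 1) : ℚ)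
      = (((1239067440 : ℚ) + (1008305142 : ℚ) * (t : ℚ) + (353479335 : ℚ) * (t : ℚ) ^ 2 + (69626317 : ℚ) * (t : ℚ) ^ 3 + (8411567 : ℚ) * (t : ℚ) ^ 4 + (636433 : ℚ) * (t : ℚ) ^ 5 + (29330 : ℚ) * (t : ℚ) ^ 6 + (748 : ℚ) * (t : ℚ) ^ 7 + (8 : ℚ) * (t : ℚ) ^ 8) - ((276756480 : ℚ) + (202069248 : ℚ) * (t : ℚ) + (62767040 : ℚ) * (t : ℚ) ^ 2 + (10753568 : ℚ) * (t : ℚ) ^ 3 + (1097600 : ℚ) * (t : ℚ) ^ 4 + (66752 : ℚ) * (t : ℚ) ^ 5 + (2240 : ℚ) * (t : ℚ) ^ 6 + (32 : ℚ) * (t : ℚ) ^ 7) * ((4 : ℚ) ^ (t + 6) / ((2 * t + 12).choose (t + 6) : ℚ))) / ((100245600 : ℚ) + (115328700 : ℚ) * (t : ℚ) + (57747366 : ℚ) * (t : ℚ) ^ 2 + (16440410 : ℚ) * (t : ℚ) ^ 3 + (2911174 : ℚ) * (t : ℚ) ^ 4 + (328370 : ℚ) * (t : ℚ) ^ 5 +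 (23044 : ℚ) * (t : ℚ) ^ 6 + (920 : ℚ) * (t : ℚ) ^ 7 + (16 : ℚ) * (t : ℚ) ^ 8) := by
  rw [slice_sum_one_eq (t + 4 + 5 + 1 + 1 + 1 + 1) (t + 4), show t + 4 + 5 + 1 + 1 + 1 + 1 + (t + 4) = 2 * t + 17 by ring]
  push_cast
  have hC : (0 : ℚ) < ((2 * t + 13).choose (t + 4) : ℚ) := by exact_mod_cast Nat.choose_pos (by omega)
  have hC' : ((2 * t + 13).choose (t + 4) : ℚ) ≠ 0 := hC.ne'
  rw [sliceFive_row4, sliceFive_row3, sliceFive_row2, sliceFive_row1, sliceFive_row0, sliceFive_C4, sliceFive_C3, sliceFive_C2, sliceFive_C1, sliceFive_cs3, sliceFive_cs2, sliceFive_cs1, sliceFive_cs0, sliceFive_cb, sliceFive_c2, sliceFive_c1]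
  field_simp
  ring

/-- `S₁(t+14, t+4)` (the row `2t+18`) in closed form `(A − B·x)/D`. -/
lemma sliceFive_S1_five (t : ℕ) :
    ∑ a ∈ range (t + 4 + 1), ((t + 4).choose a : ℚ) / ((t + 4 + 5 + 1 + 1 + 1 + 1 + 1 + 1 + a).choose (a + 1) : ℚ)
      = (((38855194560 : ℚ) + (34335157788 : ℚ) * (t : ℚ) + (13287811644 : ℚ) * (t : ℚ) ^ 2 + (2952568351 : ℚ) * (t : ℚ) ^ 3 + (414473968 : ℚ) * (t : ℚ) ^ 4 + (38035121 : ℚ) * (t : ℚ) ^ 5 + (2274496 : ℚ) * (t : ℚ) ^ 6 + (85064 : ℚ) * (t : ℚ) ^ 7 + (1792 : ℚ) * (t : ℚ) ^ 8 + (16 : ℚ) * (t : ℚ) ^ 9) - ((8717829120 : ℚ) + (6987883392 : ℚ) * (t : ℚ) + (2431817568 : ℚ) * (t : ℚ) ^ 2 + (479963232 : ℚ) * (t : ℚ) ^ 3 + (58769928 : ℚ) * (t : ℚ) ^ 4 + (4572288 : ℚ) * (t : ℚ) ^ 5 + (220752 : ℚ) * (t : ℚ) ^ 6 + (6048 : ℚ)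 * (t : ℚ) ^ 7 + (72 : ℚ) * (t : ℚ) ^ 8) * ((4 : ℚ) ^ (t + 6) / ((2 * t + 12).choose (t + 6) : ℚ))) / ((1904666400 : ℚ) + (2391736500 : ℚ) * (t : ℚ) + (1327857354 : ℚ) * (t : ℚ) ^ 2 + (427862522 : ℚ) * (t : ℚ) ^ 3 + (88193126 : ℚ) * (t : ℚ) ^ 4 + (12061378 : ℚ) * (t : ℚ) ^ 5 + (1094576 : ℚ) * (t : ℚ) ^ 6 + (63568 : ℚ) * (t : ℚ) ^ 7 + (2144 : ℚ) * (t : ℚ) ^ 8 + (32 : ℚ) * (t : ℚ) ^ 9) := by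
  rw [slice_sum_one_eq (t + 4 + 5 + 1 + 1 + 1 + 1 + 1) (t + 4), show t + 4 + 5 + 1 + 1 + 1 + 1 + 1 + (t + 4) = 2 * t + 18 by ring]
  push_cast
  have hC : (0 : ℚ) < ((2 * t + 13).choose (t + 4) : ℚ) := by exact_mod_cast Nat.choose_pos (by omega)
  have hC' : ((2 * t + 13).choose (t + 4) : ℚ) ≠ 0 := hC.ne'
  rw [sliceFive_row5, sliceFive_row4, sliceFive_row3, sliceFive_row2, sliceFive_row1, sliceFive_row0, sliceFive_C5, sliceFive_C4, sliceFive_C3, sliceFive_C2, sliceFive_C1, sliceFive_cs4, sliceFive_cs3, sliceFive_cs2, sliceFive_cs1, sliceFive_cs0, sliceFive_cb, sliceFive_c2, sliceFive_c1]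
  field_simp
  ring

end PercRepro
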